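import Literature.Analysis.FunctionSpaces.UniformlyConvexPoincare
import HarnessLib

/-!
# Poincaré inequality for first-order uniformly log-concave weights (continuous potential)

Topic `Literature/Analysis/FunctionSpaces` (functional inequalities). A companion to
`UniformlyConvexPoincare.lean`: the same `Z²`-multiplied Poincaré (spectral gap) inequality
`(∫e^{-Φ})(∫f²e^{-Φ}) − (∫fe^{-Φ})² ≤ κ⁻¹ (∫e^{-Φ}) ∫‖∇f‖²e^{-Φ}` for bounded `C¹` test functions
with bounded derivative, but under the FIRST-ORDER form of `κ`-uniform convexity
`Φ x + ⟨∇Φ x, y − x⟩ + (κ/2)‖y − x‖² ≤ Φ y` and mere continuity of `Φ` (no `C²` hypothesis, no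
Hessian) — exactly the hypotheses of the tree's proved
`Literature.Probability.Moments.variance_tilted_le` (Brascamp–Lieb 1976, Thm 4.1, uniformly convex
case, via Prékopa–Leindler), of which this file is the bookkeeping corollary: integrability of
`e^{-Φ}` (`integrable_exp_neg_of_uniformlyConvex`), of the three weighted integrands (bounded ×
integrable), transfer between `volume.tilted (−Φ)` and weighted Lebesgue integrals, and
multiplication by `Z²`. This is the form in which convexity is cheapest to verify for potentials
given as "positive-definite quadratic + convex" (e.g. pinned oscillator chains,
`Summit.AtomisticToContinuum.FouriersLaw.Theorems.floorGap_proof`), where the first-order inequality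
follows from the gradient inequality of the convex part without computing second derivatives.

* `poincare_of_firstOrderUniformlyConvex` — the statement above (fully proved, no new facts).

## References

* [BrascampLieb1976] H. J. Brascamp, E. H. Lieb, J. Funct. Anal. 22 (1976) 366–389, Thm. 4.1
  (uniformly convex case `V'' ≥ λ`: `Var(f) ≤ λ⁻¹ ∫ |∇f|² e^{-V} / ∫ e^{-V}`).
* [BakryGentilLedoux2014] D. Bakry, I. Gentil, M. Ledoux, *Analysis and Geometry of Markov Diffusion
  Operators* (2014), Prop. 4.8.1 (`CD(ρ, ∞)` ⟹ Poincaré `P(1/ρ)`).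
-/

noncomputable section

open MeasureTheory Set Filter Topology
open scoped RealInnerProductSpace

namespace Literature.Analysis.FunctionSpaces

variable {n : ℕ}

/-- **Poincaré inequality for a first-order uniformly log-concave weight** (Brascamp–Lieb 1976,
Thm. 4.1, uniformly convex case; `Z²`-multiplied form). For `Φ : ℝⁿ → ℝ` continuous with
`Φ x + ⟨∇Φ x, y − x⟩ + (κ/2)‖y − x‖² ≤ Φ y` for all `x, y` (`κ > 0`) and every `C¹` function `f`
bounded with bounded derivative:
`(∫e^{-Φ})(∫f²e^{-Φ}) − (∫fe^{-Φ})² ≤ κ⁻¹ (∫e^{-Φ}) ∫‖∇f‖²e^{-Φ}`.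
Corollary of `Literature.Probability.Moments.variance_tilted_le`.
[cite: BrascampLieb1976, Thm 4.1] -/
theorem poincare_of_firstOrderUniformlyConvex {Φ : EuclideanSpace ℝ (Fin n) → ℝ} {κ : ℝ}
    (hκ : 0 < κ) (hΦc : Continuous Φ)
    (hconv : ∀ x y : EuclideanSpace ℝ (Fin n),
      Φ x + ⟪gradient Φ x, y - x⟫ + κ / 2 * ‖y - x‖ ^ 2 ≤ Φ y)
    {f : EuclideanSpace ℝ (Fin n) → ℝ} (hf : ContDiff ℝ 1 f)
    (hbd : ∃ C : ℝ, ∀ x, |f x| ≤ C ∧ ‖fderiv ℝ f x‖ ≤ C) :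
    (∫ x, Real.exp (-Φ x)) * (∫ x, f x ^ 2 * Real.exp (-Φ x)) -
        (∫ x, f x * Real.exp (-Φ x)) ^ 2 ≤
      κ⁻¹ * (∫ x, Real.exp (-Φ x)) * ∫ x, ‖gradient f x‖ ^ 2 * Real.exp (-Φ x) := by
  obtain ⟨C, hC⟩ := hbd
  have hZ : Integrable fun x => Real.exp (-Φ x) :=
    integrable_exp_neg_of_uniformlyConvex hκ hΦc hconv
  have hfc : Continuous f := hf.continuous
  have hgrad : ∀ x, ‖gradient f x‖ = ‖fderiv ℝ f x‖ := fun x => by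
    unfold gradient; simp
  simp_rw [hgrad]
  have hgc : Continuous fun x => ‖fderiv ℝ f x‖ ^ 2 :=
    ((hf.continuous_fderiv one_ne_zero).norm).pow 2
  -- integrability of the three weighted integrands (bounded × integrable)
  have h1 : Integrable fun x => f x * Real.exp (-Φ x) :=
    hZ.bdd_mul hfc.aestronglyMeasurable (Eventually.of_forall fun x => by
      rw [Real.norm_eq_abs]; exact (hC x).1)
  have h2 : Integrable fun x => f x ^ 2 * Real.exp (-Φ x) :=
    hZ.bdd_mul (c := C ^ 2) (hfc.pow 2).aestronglyMeasurable (Eventually.of_forall fun x => by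
      rw [Real.norm_eq_abs, abs_of_nonneg (sq_nonneg _), ← sq_abs]
      exact pow_le_pow_left₀ (abs_nonneg _) (hC x).1 2)
  have h3 : Integrable fun x => ‖fderiv ℝ f x‖ ^ 2 * Real.exp (-Φ x) :=
    hZ.bdd_mul (c := C ^ 2) hgc.aestronglyMeasurable (Eventually.of_forall fun x => by
      rw [Real.norm_eq_abs, abs_of_nonneg (sq_nonneg _)]
      exact pow_le_pow_left₀ (norm_nonneg _) (hC x).2 2)
  -- transfer of integrals and integrability to `ν = volume.tilted (-Φ)`
  have T : ∀ g : EuclideanSpace ℝ (Fin n) → ℝ, ∫ x, g x ∂(volume.tilted fun x => -Φ x) =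
      (∫ x, g x * Real.exp (-Φ x)) / ∫ x, Real.exp (-Φ x) := fun g => by
    rw [integral_tilted, ← integral_div]
    congr 1; ext x; rw [smul_eq_mul]; ring
  have I : ∀ g : EuclideanSpace ℝ (Fin n) → ℝ, Integrable (fun x => g x * Real.exp (-Φ x)) →
      Integrable g (volume.tilted fun x => -Φ x) := fun g hg => by
    rw [integrable_tilted_iff hZ]
    refine hg.congr (Eventually.of_forall fun x => ?_)
    simp only [smul_eq_mul]; ring
  -- the variance inequality under `ν` (proved in the tree)
  have key := Literature.Probability.Moments.variance_tilted_le hκ hΦc hconv hZ hf (I _ h1) (I _ h2)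
    (I _ h3)
  rw [T, T, T] at key
  have hZpos : 0 < ∫ x, Real.exp (-Φ x) := integral_exp_pos hZ
  set Z : ℝ := ∫ x, Real.exp (-Φ x) with hZ_def
  set A : ℝ := ∫ x, f x * Real.exp (-Φ x) with hA_def
  set B : ℝ := ∫ x, f x ^ 2 * Real.exp (-Φ x) with hB_def
  set D : ℝ := ∫ x, ‖fderiv ℝ f x‖ ^ 2 * Real.exp (-Φ x) with hD_def
  -- `key : B / Z - (A / Z) ^ 2 ≤ κ⁻¹ * (D / Z)`; multiply through by `Z² > 0`
  have hZne : Z ≠ 0 := hZpos.ne'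
  have hk : Z ^ 2 * (B / Z - (A / Z) ^ 2) ≤ Z ^ 2 * (κ⁻¹ * (D / Z)) :=
    mul_le_mul_of_nonneg_left key (sq_nonneg Z)
  have e1 : Z ^ 2 * (B / Z - (A / Z) ^ 2) = Z * B - A ^ 2 := by
    field_simp
  have e2 : Z ^ 2 * (κ⁻¹ * (D / Z)) = κ⁻¹ * Z * D := by
    field_simp
  rw [e1, e2] at hk
  exact hk

end Literature.Analysis.FunctionSpaces

end
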